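import Summits.BirchSwinnertonDyer.BirchSwinnertonDyer.Theorems.InertBadSignedBranchesCccOneLawOnTypeIstarZeroPackageRigidity
import Summits.BirchSwinnertonDyer.Rank1Residual.X12.ClassClosureO10RubinEta
import HarnessLib

set_option linter.dupNamespace false
set_option autoImplicit false

/-!
# `CccOneLawOnTypeIstarZero` (stmt-BirchSwinnertonDyer-19223), line `kato_perrin_riou_istar` v11 —
# the research stub 2c VERBATIM from an ADMISSIBLE KOBAYASHI PACKAGE («Kobayashi's `η`-class IS Kato's class of `W`»)

Refill hand `leafhand-bsd-inertbadsignedbran-6` g0 (prover), 2026-08-31; DEF-FREE helper `--supports 19223 --as helper`;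
companion of hand -5's `Theorems/InertBadSignedBranchesCccOneLawOnTypeIstarZeroPackageRigidity{,ValueLaw,Rescaling}.lean`.
Skeleton of record `Cruxes/CccOneLawOnTypeIstarZero/Lines/kato_perrin_riou_istar.lean` v11, sha `d5290a4395abfc6e`
(planner bsd-cm-plan g39, D1154).  Nothing here is registered, no stub is closed, nothing is asserted about the open items
19865 / 19867 / 19223 or about the named facts used as hypotheses; BSD is proved for no curve.

## What this file proves (kernel) — a SECOND typed door for stub 2c

The registered research stub 2c `KatoPerrinRiouIstar.stub_muColPlusAdmissibleIstarZero` («`μ(Col⁺(loc z₀)) = μ(L_p⁺(V, η, X))`»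
for every Kobayashi package `P : Kobayashi2003.EtaColemanPoitouTateData …` and every ADMISSIBLE Kato class `z₀` of the additive
twist `W = V ⊗ η` on the rows `(p, I₀*)`, `p ≥ 5`, `r_an = 1`) was reduced by hand -5 to a VALUE LAW
(`CccOnePackageRigidity.stub2c_of_valueLaw'`: «∀ admissible `z₀` ∃ package `P₀`, `Col⁺_{P₀}(z₀)` is a plus `L`-function»).
This file gives the IDENTIFICATION form of the same residual, which is the shape of a one-field strengthening of the
Kobayashi package fact (pattern of `Kobayashi2003.EtaColemanPoitouTateZetaData.isEulerSystemClass_z`):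

  (ADM)  «there is a Kobayashi `η`-package `P₁` on the pin whose class `P₁.z` — Kobayashi's `ε_η z_{η(−1)}` for the good
         twin `V`, read in `𝐇¹_Γ(T_pW)` — is an ADMISSIBLE Kato zeta class of `W` (`Kato2004.IsAdmissibleZetaClass W p κ hκ I P₁.z`)»,

i.e. the twist-compatibility of Kato's zeta elements along `W = V ⊗ η` with a `p`-ADIC UNIT constant (Kato Thm. 12.5 (1) for
`f_V` at the characters `ηχ` and for `f_W` at `χ`, Rubin's twisting of Euler systems by characters of finite order, and the
period/differential bookkeeping along the `ℚ(√p*)`-isomorphism `V ≅ W` — hand -5's memo DERIVATION-ZC finds the constant to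
be a unit; NOT asserted here).

* §1 `stub2c_of_admissible_kobayashiClass` — on ONE pin `I` of the `η`-frame: granted 19867 `PublishedInputsEtaUpToP`, the
  named fact ★ `Kato2004.exists_zetaClassPosition_of_rank_le_one` (Kato Thm. 12.5 (1)(2) / §13.9 on the rank-`≤ 1` branch)
  and `rank_{ℤ_p} H¹(ℤ[1/p], T_pW) ≤ 1` (a tree theorem from Mordell–Weil rank one and `Ш(W)[p^∞]` finite,
  `LocPKummer.rank_integralH1_le_one`): if SOME package `P₁` on the pin has an admissible class `P₁.z`, then the stub-2c
  equality holds for EVERY package `P` and EVERY admissible `z₀` on the pin.  Proof: admissible classes of the pin are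
  `Λˣ`-multiples of each other (★, `admissible_eq_units_smul_of_rank_integralH1_le_one`), so `z₀ = w • P₁.z`, `w ∈ Λˣ` —
  hands -3 and -4's «ZC» at the package `P₁` — and hand -5's `CccOnePackageRigidity.stub2c_of_exists_units_smul` (granted
  19867) transports the stub-2c equality from `P₁` to `P`.
* §1 `stub2c_of_admissible_kobayashiClass_of_rankOne` — the same with the rank input read from `W.mordellWeilRank = 1` and
  `Ш(W)[p^∞]` finite.
* §2 `stub2c_of_admissiblePackage` — **the REGISTERED SIGNATURE of stub 2c, TYPE VERBATIM**, from 19867 + ★ + GZK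
  (`rank_eq_analyticRank_of_analyticRank_le_one`, the line's `stub_printInputsInert.2`) + (ADM) stated in the frame of
  `Kobayashi2003.thm62_63_73_etaColemanPoitouTate` («∀ frame ∀ W ∀ pin I, ∃ FB₁ P₁, IsAdmissibleZetaClass W p κ hκ I P₁.z»).
  On the rows: `r_an = 1` ⟹ (GZK) Mordell–Weil rank one and `Ш(W)` finite ⟹ `rank_{ℤ_p} H¹(ℤ[1/p], T_pW) ≤ 1`; then §1.

COMPARISON OF THE TWO DOORS (for the planner; both are hypotheses here, neither is typed in the tree).  Hand -5's (VL′)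
quantifies a Coleman value law over all admissible classes INSIDE the strengthened fact; (ADM) is ONE identification field on
Kobayashi's own class and costs ★ (an existing Literature named fact, already used by hands -4 and -5) and GZK (already the
line's `stub_printInputsInert.2`).  In the intended model the two are equivalent and each is equivalent, on a pin, to stub 2c
itself: the classes `𝐳_{γ_W}` (admissible) and `ε_η z_{η(−1)}` (Kobayashi) have proportional `exp*`-values at every
character of `Γ`, so they differ by a CONSTANT `c ∈ ℚ_pˣ` in `𝐇¹_Γ(T_pW) ⊗ ℚ` (Kato Thm. 12.4 (2) + Rohrlich), and
stub 2c ⟺ `v_p(c) = 0` ⟺ (ADM) ⟺ (VL′) (hand -4's integer `e = m − n` is `±v_p(c)`).  So (ADM) adds no strength beyond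
stub 2c on the rows; it is merely the print-shaped name of the residual.

Honest label: bookkeeping only; closes no stub; 19223 stays OPEN; nothing is asserted about ★, 19867, GZK or (ADM).
-/

noncomputable section

open scoped Classical

open CongruenceSubgroup WeierstrassCurve Field Literature.NumberTheory.EllipticCurves
  Literature.NumberTheory.EllipticCurves.ModularForms Literature.NumberTheory.EllipticCurves.IwasawaAlgebra
  Literature.NumberTheory.EllipticCurves.Kato2004 ZpExtension Module
open Literature.NumberTheory.EllipticCurves.Kato2004.EulerSystemValues (tateRep)
open Summit.BirchSwinnertonDyer.Rank1Residual.X12.O10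
open Summit.BirchSwinnertonDyer.BirchSwinnertonDyer.Theses.InertBadSignedBranches

namespace Summit.BirchSwinnertonDyer.BirchSwinnertonDyer.Theorems.CccOneAdmissiblePackage

variable {p : ℕ} [Fact p.Prime]

/-! ## §1 On one pin: an admissible Kobayashi class gives stub 2c for every package and every admissible class -/

section Pin

variable (hp : p ≠ 2) (K₀ : Type) [Field K₀] [NumberField K₀]
  [IsCyclotomicExtension {p} ℚ K₀] [(galRange (K := ℚ) K₀).Normal]
  (η : absoluteGaloisGroup ℚ →* ℤˣ) (hη : ∀ σ ∈ galRange (K := ℚ) K₀, η σ = 1) (hη1 : η ≠ 1)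
  (V : WeierstrassCurve ℚ) [V.IsElliptic] [V.IsGloballyMinimal] {N : ℕ} [NeZero N]
  {f : CuspForm (Gamma0 N) 2} (hCM : V.HasCM) (hgood : V.HasGoodReductionAtPrime p)
  (hap : V.frobeniusTrace p = 0) (hf : IsNewformOf V f) (ϖ : ℚ)
  (hϖ : if Even (p / 2) then (ϖ : ℝ) * V.realPeriodRat = plusPeriod f
    else (ϖ : ℝ) * V.imaginaryPeriodRat = minusPeriod f)
  (κ : ZpExtension ℚ p) (γ : absoluteGaloisGroup ℚ) (hκ : κ.IsCyclotomic) (hγ : κ.IsTopGenerator γ)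
  (hγK : γ ∈ galRange (K := ℚ) K₀) (hvar : IsCyclotomicVariable p γ)
  (W : WeierstrassCurve ℚ) [W.IsElliptic] [W.IsGloballyMinimal] [ContinuousSMul ℤ_[p] (W.tateModule p)]
  (I : Kato2004.IwasawaH1Data W p κ γ)

include hp hη hη1 hCM hgood hap hf hϖ hγ hγK hvar

/-- **An admissible Kobayashi class on the pin ⟹ stub 2c for every package and every admissible class on the pin**
(granted 19867, ★ and `rank_{ℤ_p} H¹(ℤ[1/p], T_pW) ≤ 1`).  If ONE Kobayashi `η`-package `P₁` on `(I, FB₁)` has its class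
`P₁.z` ADMISSIBLE for `W` («Kobayashi's `ε_η z_{η(−1)}` of the good twin, read in `𝐇¹_Γ(T_pW)`, is Kato's `Ω_W`-normalised
zeta class `𝐳_{γ_W}` up to `Λˣ`»), then for EVERY package `P` on `(I, FB)` and EVERY admissible `z₀`:
`length_𝔮 (Λ ⧸ (P.colPlus z₀)) = length_𝔮 (Λ ⧸ (P.colPlus P.z))` at `𝔮 = (p)`.  By ★ on the rank-`≤ 1` branch the two
admissible classes differ by a unit of `Λ` (`admissible_eq_units_smul_of_rank_integralH1_le_one`), which is «ZC» at `P₁`; hand -5's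
`CccOnePackageRigidity.stub2c_of_exists_units_smul` moves it to `P`.  Conditional on its displayed hypotheses; nothing asserted.
[cite: Kato2004Asterisque, Thm. 12.5 (1) (p. 221), §13.9 (p. 230 l. 4–9), Thm. 12.4 (2) (p. 221), Conj. 12.10 (p. 224)]
[cite: Kobayashi2003, Thm. 5.2 (p. 9), Thm. 6.3 (p. 11), Thm. 7.3 i) (p. 13)] [cite: Rubin2000, Ch. II §4 (twisting by characters of finite order)]
[cite: BurungaleTian2026, Rem. 2.7 (p. 5)] -/
theorem stub2c_of_admissible_kobayashiClass (hF : PublishedInputsEtaUpToP)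
    (hstar : exists_zetaClassPosition_of_rank_le_one)
    (hrank : Module.rank ℤ_[p] (integralH1 (tateRep W p) p (κ.layerSubgroup 0)) ≤ 1)
    {FB₁ : W.FineSelmerDualData κ γ} (P₁ : Kobayashi2003.EtaColemanPoitouTateData p K₀ η V f ϖ κ γ W I FB₁)
    (hP₁ : IsAdmissibleZetaClass W p κ hκ I P₁.z)
    {FB : W.FineSelmerDualData κ γ} (P : Kobayashi2003.EtaColemanPoitouTateData p K₀ η V f ϖ κ γ W I FB)
    {z₀ : I.H} (hz₀ : IsAdmissibleZetaClass W p κ hκ I z₀)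
    (𝔮 : PrimeSpectrum (IwasawaAlgebra p)) (h𝔮 : 𝔮.asIdeal = augIdealP p) :
    lengthAt (IwasawaAlgebra p) (IwasawaAlgebra p ⧸ Ideal.span {P.colPlus z₀}) 𝔮 =
      lengthAt (IwasawaAlgebra p) (IwasawaAlgebra p ⧸ Ideal.span {P.colPlus P.z}) 𝔮 := by
  -- «ZC» at `P₁`: the two admissible classes `P₁.z`, `z₀` differ by a unit of `Λ` (★ on the rank-≤ 1 branch)
  obtain ⟨w, hw⟩ :=
    hstar.admissible_eq_units_smul_of_rank_integralH1_le_one hκ hγ hp I hrank hP₁ hz₀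
  -- transport from `P₁` to `P` (granted 19867)
  exact CccOnePackageRigidity.stub2c_of_exists_units_smul hp K₀ η hη hη1 V hCM hgood hap hf ϖ hϖ κ γ hκ hγ hγK hvar
    W I hF P₁ hz₀ ⟨w, hw⟩ P 𝔮 h𝔮

/-- **The same with the rank input read from Mordell–Weil rank one and `Ш(W)[p^∞]` finite** (Kato (14.9.3) ⊗ ℚ at rank one:
`LocPKummer.rank_integralH1_le_one`). Conditional on its displayed hypotheses; nothing asserted.
[cite: Kato2004Asterisque, §14.9 (14.9.3) (p. 240), Thm. 12.5 (1) (p. 221), §13.9 (p. 230 l. 4–9)]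
[cite: Kobayashi2003, Thm. 6.3 (p. 11), Thm. 7.3 i) (p. 13)] -/
theorem stub2c_of_admissible_kobayashiClass_of_rankOne (hF : PublishedInputsEtaUpToP)
    (hstar : exists_zetaClassPosition_of_rank_le_one)
    (hrk : W.mordellWeilRank = 1) (hsha : Finite (AddCommGroup.primaryComponent W.sha p))
    {FB₁ : W.FineSelmerDualData κ γ} (P₁ : Kobayashi2003.EtaColemanPoitouTateData p K₀ η V f ϖ κ γ W I FB₁)
    (hP₁ : IsAdmissibleZetaClass W p κ hκ I P₁.z)
    {FB : W.FineSelmerDualData κ γ} (P : Kobayashi2003.EtaColemanPoitouTateData p K₀ η V f ϖ κ γ W I FB)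
    {z₀ : I.H} (hz₀ : IsAdmissibleZetaClass W p κ hκ I z₀)
    (𝔮 : PrimeSpectrum (IwasawaAlgebra p)) (h𝔮 : 𝔮.asIdeal = augIdealP p) :
    lengthAt (IwasawaAlgebra p) (IwasawaAlgebra p ⧸ Ideal.span {P.colPlus z₀}) 𝔮 =
      lengthAt (IwasawaAlgebra p) (IwasawaAlgebra p ⧸ Ideal.span {P.colPlus P.z}) 𝔮 :=
  stub2c_of_admissible_kobayashiClass hp K₀ η hη hη1 V hCM hgood hap hf ϖ hϖ κ γ hκ hγ hγK hvar W I hF hstar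
    (Summit.BirchSwinnertonDyer.Rank1Residual.Additive.LocPKummer.rank_integralH1_le_one W p κ hrk hsha)
    P₁ hP₁ P hz₀ 𝔮 h𝔮

end Pin

/-! ## §2 The registered stub 2c, TYPE VERBATIM, from 19867 + ★ + GZK + (ADM) -/

/-- **Stub 2c `stub_muColPlusAdmissibleIstarZero` — TYPE VERBATIM — from 19867 `PublishedInputsEtaUpToP`, ★
`Kato2004.exists_zetaClassPosition_of_rank_le_one`, GZK `rank_eq_analyticRank_of_analyticRank_le_one` and the
identification (ADM) «in every `η`-frame of `Kobayashi2003.thm62_63_73_etaColemanPoitouTate`, on every pin `I` of a globally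
minimal model `W` of `V^{(p*)}`, SOME Kobayashi package has an ADMISSIBLE class».**  On the rows (`p ≥ 5`, signed type
`(p, I₀*)`, `r_an = 1`): GZK gives Mordell–Weil rank one and `Ш(W)` finite, hence `rank_{ℤ_p} H¹(ℤ[1/p], T_pW) ≤ 1`; then
§1 `stub2c_of_admissible_kobayashiClass`.  (ADM) is the twist-compatibility of Kato's zeta elements along `W = V ⊗ η` with a
`p`-adic unit constant, the natural one-field strengthening (`isAdmissible_z`) of the package fact; it is a HYPOTHESIS here
(paper status: hand -5's memo DERIVATION-ZC, nearest print Burungale–Skinner–Tian–Wan 2024 §1.5 for `p ∤ disc`), as are the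
open named-fact item 19867 and the named facts ★ / GZK.  Nothing is asserted; no stub is closed by this theorem.
[cite: Kato2004Asterisque, Thm. 12.5 (1) (p. 221), §13.9 (p. 230 l. 4–9), Thm. 12.4 (2) (p. 221), §14.9 (14.9.3) (p. 240), Conj. 12.10 (p. 224)]
[cite: Kobayashi2003, Thm. 5.2 (p. 9), Thm. 6.2–6.3 (p. 11), Thm. 7.3 i) (p. 13)] [cite: BurungaleTian2026, Rem. 2.7 (p. 5)]
[cite: BurungaleSkinnerTianWan2024, §1.5, Lemmas 1.13, 1.16, 1.18 (pp. 18–21)] [cite: Darmon2004, Thm. 3.22] -/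
theorem stub2c_of_admissiblePackage (hF : PublishedInputsEtaUpToP)
    (hstar : exists_zetaClassPosition_of_rank_le_one)
    (hGZK : rank_eq_analyticRank_of_analyticRank_le_one)
    (hADM : ∀ (p : ℕ) [Fact p.Prime] (K₀ : Type) [Field K₀] [NumberField K₀] [IsCyclotomicExtension {p} ℚ K₀]
      [(galRange (K := ℚ) K₀).Normal] (η : absoluteGaloisGroup ℚ →* ℤˣ),
      (∀ σ ∈ galRange (K := ℚ) K₀, η σ = 1) → η ≠ 1 →
      ∀ (V : WeierstrassCurve ℚ) [V.IsElliptic] [V.IsGloballyMinimal] {N : ℕ} [NeZero N]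
        {f : CuspForm (Gamma0 N) 2},
        p ≠ 2 → V.HasGoodReductionAtPrime p → V.frobeniusTrace p = 0 → IsNewformOf V f →
      ∀ (ϖ : ℚ), (if Even (p / 2) then (ϖ : ℝ) * V.realPeriodRat = plusPeriod f
          else (ϖ : ℝ) * V.imaginaryPeriodRat = minusPeriod f) →
      ∀ (κ : ZpExtension ℚ p) (hκ : κ.IsCyclotomic) (γ : absoluteGaloisGroup ℚ),
        κ.IsTopGenerator γ → γ ∈ galRange (K := ℚ) K₀ → IsCyclotomicVariable p γ →
      ∀ (W : WeierstrassCurve ℚ) [W.IsElliptic] [W.IsGloballyMinimal] [ContinuousSMul ℤ_[p] (W.tateModule p)]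
        (C : VariableChange ℚ), C • W.quadraticTwist ((-1) ^ (p / 2) * p) = V →
      ∀ (I : Kato2004.IwasawaH1Data W p κ γ),
        ∃ (FB₁ : W.FineSelmerDualData κ γ) (P₁ : Kobayashi2003.EtaColemanPoitouTateData p K₀ η V f ϖ κ γ W I FB₁),
          Kato2004.IsAdmissibleZetaClass W p κ hκ I P₁.z) :
    ∀ (p : ℕ) [Fact p.Prime], 5 ≤ p → ∀ (W : WeierstrassCurve ℚ) [W.IsElliptic] [W.IsGloballyMinimal],
      HasSignedLocalType W p (.Istar 0) → W.analyticRank = 1 →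
      letI : ContinuousSMul ℤ_[p] (W.tateModule p) := TateModule.continuousSMul_padicInt
      ∀ (K₀ : Type) [Field K₀] [NumberField K₀] [IsCyclotomicExtension {p} ℚ K₀] [(galRange (K := ℚ) K₀).Normal]
        (η : Field.absoluteGaloisGroup ℚ →* ℤˣ), (∀ σ ∈ galRange (K := ℚ) K₀, η σ = 1) → η ≠ 1 →
      ∀ (V : WeierstrassCurve ℚ) [V.IsElliptic] [V.IsGloballyMinimal] {N : ℕ} [NeZero N]
        {f : CuspForm (CongruenceSubgroup.Gamma0 N) 2},
        V.HasCM → V.HasGoodReductionAtPrime p → V.frobeniusTrace p = 0 → ModularForms.IsNewformOf V f →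
      ∀ (ϖ : ℚ), (if Even (p / 2) then (ϖ : ℝ) * V.realPeriodRat = ModularForms.plusPeriod f
          else (ϖ : ℝ) * V.imaginaryPeriodRat = ModularForms.minusPeriod f) →
      ∀ (κ : ZpExtension ℚ p) (hκ : κ.IsCyclotomic) (γ : Field.absoluteGaloisGroup ℚ) (_ : κ.IsTopGenerator γ),
        γ ∈ galRange (K := ℚ) K₀ → IsCyclotomicVariable p γ →
      ∀ (C : VariableChange ℚ), C • W.quadraticTwist ((-1) ^ (p / 2) * p) = V →
      ∀ (I : IwasawaH1Data W p κ γ) (FB : W.FineSelmerDualData κ γ)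
        (P : Kobayashi2003.EtaColemanPoitouTateData p K₀ η V f ϖ κ γ W I FB)
        (z₀ : I.H), Kato2004.IsAdmissibleZetaClass W p κ hκ I z₀ →
        ∀ (𝔮 : PrimeSpectrum (IwasawaAlgebra p)), 𝔮.asIdeal = IwasawaAlgebra.augIdealP p →
          Module.lengthAt (IwasawaAlgebra p) (IwasawaAlgebra p ⧸ Ideal.span {P.colPlus z₀}) 𝔮 =
            Module.lengthAt (IwasawaAlgebra p) (IwasawaAlgebra p ⧸ Ideal.span {P.colPlus P.z}) 𝔮 := by
  intro p _ hp5 W _ _ _ hr K₀ _ _ _ _ η hη hη1 V _ _ N _ f hCM hgood hap hf ϖ hϖ κ hκ γ hγ hγK hvar C hC I FB P z₀ hz₀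
    𝔮 h𝔮
  have hp2 : p ≠ 2 := by omega
  letI : ContinuousSMul ℤ_[p] (W.tateModule p) := TateModule.continuousSMul_padicInt
  -- GZK on the row: Mordell–Weil rank one and `Ш(W)` finite
  obtain ⟨hmw, hfinSha⟩ := hGZK W (by rw [hr])
  have hrk : W.mordellWeilRank = 1 := by rw [hmw, hr]
  haveI : Finite W.sha := hfinSha
  have hsha : Finite (AddCommGroup.primaryComponent W.sha p) := inferInstance
  -- the admissible Kobayashi package on the pin
  obtain ⟨FB₁, P₁, hP₁⟩ := hADM p K₀ η hη hη1 V hp2 hgood hap hf ϖ hϖ κ hκ γ hγ hγK hvar W C hC I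
  exact stub2c_of_admissible_kobayashiClass_of_rankOne hp2 K₀ η hη hη1 V hCM hgood hap hf ϖ hϖ κ γ hκ hγ hγK hvar W I
    hF hstar hrk hsha P₁ hP₁ P hz₀ 𝔮 h𝔮

/-! ## §3 (appended, same hand) The split PRINT ∣ RESEARCH of the residual: under a `ℚ_pˣ`-proportionality
`p^a • P₁.z = p^b • z₁` (print), stub 2c on the pin ⟺ the one integer identity `a = b` -/

section Split

variable (hp : p ≠ 2) (K₀ : Type) [Field K₀] [NumberField K₀]
  [IsCyclotomicExtension {p} ℚ K₀] [(galRange (K := ℚ) K₀).Normal]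
  (η : absoluteGaloisGroup ℚ →* ℤˣ) (hη : ∀ σ ∈ galRange (K := ℚ) K₀, η σ = 1) (hη1 : η ≠ 1)
  (V : WeierstrassCurve ℚ) [V.IsElliptic] [V.IsGloballyMinimal] {N : ℕ} [NeZero N]
  {f : CuspForm (Gamma0 N) 2} (hCM : V.HasCM) (hgood : V.HasGoodReductionAtPrime p)
  (hap : V.frobeniusTrace p = 0) (hf : IsNewformOf V f) (ϖ : ℚ)
  (hϖ : if Even (p / 2) then (ϖ : ℝ) * V.realPeriodRat = plusPeriod f
    else (ϖ : ℝ) * V.imaginaryPeriodRat = minusPeriod f)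
  (κ : ZpExtension ℚ p) (γ : absoluteGaloisGroup ℚ) (hκ : κ.IsCyclotomic) (hγ : κ.IsTopGenerator γ)
  (hγK : γ ∈ galRange (K := ℚ) K₀) (hvar : IsCyclotomicVariable p γ)
  (W : WeierstrassCurve ℚ) [W.IsElliptic] [W.IsGloballyMinimal] [ContinuousSMul ℤ_[p] (W.tateModule p)]
  (I : Kato2004.IwasawaH1Data W p κ γ)

include hp hη hη1 hCM hgood hap hf hϖ hγ hγK hvar

/-- **Stub 2c on a pin ⟺ `a = b`, under a `ℚ_pˣ`-PROPORTIONALITY of the two zeta lines** (granted 19867, ★ and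
`rank_{ℤ_p} H¹(ℤ[1/p], T_pW) ≤ 1`).  Suppose ONE Kobayashi package `P₁` on the pin, ONE admissible Kato class `z₁` of `W`
and exponents `a b : ℕ` satisfy `(p : Λ)^a • P₁.z = (p : Λ)^b • z₁` — (T1): «Kobayashi's `ε_η z_{η(−1)}` and Kato's
`𝐳_{γ_W}` are `ℚ_pˣ`-proportional in `𝐇¹_Γ(T_pW) ⊗ ℚ`», which is PRINT with no period computation: both classes have
`exp*`-values proportional by a constant at every character of `Γ` (Kato Thm. 12.5 (1) for `f_V` at `ηχ` and for
`f_W = f_V ⊗ η` at `χ`, `L(V, ηχ, 1) = L(W, χ, 1)`), hence are proportional by Thm. 12.4 (2) + Rohrlich (= ★ on the branch),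
the prime-to-`p` part of the constant being absorbed into `z₁` (`IsAdmissibleZetaClass.units_smul`).  THEN for EVERY package
`P` and EVERY admissible `z₀` on the pin, the stub-2c equality `length_(p) (Λ ⧸ (P.colPlus z₀)) = length_(p) (Λ ⧸ (P.colPlus P.z))`
holds IF AND ONLY IF `a = b`.  So, once (T1) is typed, the registered stub 2c is equivalent on each pin to the single
integer identity (T2) «`a = b`» (hand -4's `e = 0`; the `p`-adic valuation of the twist-period / differential constant along
`V ≅ W` over `ℚ(√p*)`) — and (ADM) of §2 is (T1) ∧ (T2).  Proof: hand -4's Coleman-image form and `μ`-reading of a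
collinearity (`CccOneCollinearMu.zcMu_iff_lengthAt_colPlus`, `lengthAt_quotient_span_eq_iff_of_collinear` with trivial
prime-to-`p` parts), ★ (`lengthAt_quotient_span_eq_of_admissible_pair`) and hand -5's package independence
(`CccOnePackageRigidity.lengthAt_quotient_kobayashiClass_eq_of_packages`, granted 19867).  Conditional on its displayed
hypotheses; nothing asserted.
[cite: Kato2004Asterisque, Thm. 12.5 (1) (p. 221), Thm. 12.4 (2) (p. 221), §13.9 (p. 230 l. 4–9), Conj. 12.10 (p. 224)]
[cite: Kobayashi2003, Thm. 5.2 (p. 9), Thm. 6.3 (p. 11), Thm. 7.3 i) (p. 13)] [cite: Washington1997, §13.2]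
[cite: BurungaleTian2026, Rem. 2.7 (p. 5)] -/
theorem stub2c_iff_exponent_eq (hF : PublishedInputsEtaUpToP)
    (hstar : exists_zetaClassPosition_of_rank_le_one)
    (hrank : Module.rank ℤ_[p] (integralH1 (tateRep W p) p (κ.layerSubgroup 0)) ≤ 1)
    {FB₁ : W.FineSelmerDualData κ γ} (P₁ : Kobayashi2003.EtaColemanPoitouTateData p K₀ η V f ϖ κ γ W I FB₁)
    {z₁ : I.H} (hz₁ : IsAdmissibleZetaClass W p κ hκ I z₁) {a b : ℕ}
    (hT1 : ((p : IwasawaAlgebra p) ^ a) • P₁.z = ((p : IwasawaAlgebra p) ^ b) • z₁)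
    {FB : W.FineSelmerDualData κ γ} (P : Kobayashi2003.EtaColemanPoitouTateData p K₀ η V f ϖ κ γ W I FB)
    {z₀ : I.H} (hz₀ : IsAdmissibleZetaClass W p κ hκ I z₀)
    (𝔮 : PrimeSpectrum (IwasawaAlgebra p)) (h𝔮 : 𝔮.asIdeal = augIdealP p) :
    (lengthAt (IwasawaAlgebra p) (IwasawaAlgebra p ⧸ Ideal.span {P.colPlus z₀}) 𝔮 =
        lengthAt (IwasawaAlgebra p) (IwasawaAlgebra p ⧸ Ideal.span {P.colPlus P.z}) 𝔮) ↔ a = b := by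
  have hrankΛ : Module.rank (IwasawaAlgebra p) I.H ≤ 1 := I.rank_le_one_of_rank_integralH1_le_one hκ hγ hrank
  have hz₁0 : z₁ ≠ 0 := CccOneCollinearMu.ne_zero_of_isAdmissibleZetaClass I hγ hz₁
  have hPz0 : P₁.z ≠ 0 := by
    intro h0
    apply CccOnePackageRigidity.colPlus_z_ne_zero hp K₀ η V hgood hf ϖ hϖ κ γ W I P₁
    rw [h0, map_zero]
  haveI : Nontrivial I.H := nontrivial_of_ne z₁ 0 hz₁0
  have hrank1 : Module.rank (IwasawaAlgebra p) I.H = 1 := I.rank_eq_one_of_rank_integralH1_le_one hκ hγ hrank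
  have hfin : lengthAt (IwasawaAlgebra p) (I.H ⧸ (IwasawaAlgebra p) ∙ P₁.z) 𝔮 ≠ ⊤ :=
    CccOneCollinearMu.lengthAt_quotient_span_ne_top I hκ hγ hrank1 hPz0 𝔮 h𝔮
  have h1 : (1 : IwasawaAlgebra p) ∉ augIdealP p := by
    rw [← h𝔮]
    exact fun h => 𝔮.isPrime.ne_top ((Ideal.eq_top_iff_one _).mpr h)
  have hC : PowerSeries.C (p : ℤ_[p]) = (p : IwasawaAlgebra p) := map_natCast _ p
  have hcol : (PowerSeries.C (p : ℤ_[p]) ^ b * 1) • z₁ = (PowerSeries.C (p : ℤ_[p]) ^ a * 1) • P₁.z := by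
    rw [mul_one, mul_one, hC]
    exact hT1.symm
  -- stub 2c at `(P, z₀)` ⟺ «ZC-μ» at `(z₀, P.z)` ⟺ «ZC-μ» at `(z₁, P₁.z)` ⟺ `b = a`
  rw [← CccOneCollinearMu.zcMu_iff_lengthAt_colPlus P hγ hz₀ 𝔮 h𝔮,
    CccOneCollinearMu.lengthAt_quotient_span_eq_of_admissible_pair I hstar hγ hp hrankΛ hz₀ hz₁ 𝔮,
    CccOnePackageRigidity.lengthAt_quotient_kobayashiClass_eq_of_packages hp K₀ η hη hη1 V hCM hgood hap hf ϖ hϖ κ γ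
      hκ hγ hγK hvar W I P P₁ hF 𝔮 h𝔮,
    CccOneCollinearMu.lengthAt_quotient_span_eq_iff_of_collinear I hγ hz₁0 hPz0 h1 h1 hcol 𝔮 h𝔮 hfin]
  exact eq_comm

/-- **Row form of `stub2c_iff_exponent_eq`** (rank input from Mordell–Weil rank one and `Ш(W)[p^∞]` finite).
[cite: Kato2004Asterisque, §14.9 (14.9.3) (p. 240), Thm. 12.5 (1) (p. 221)] [cite: Kobayashi2003, Thm. 6.3 (p. 11)] -/
theorem stub2c_iff_exponent_eq_of_rankOne (hF : PublishedInputsEtaUpToP)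
    (hstar : exists_zetaClassPosition_of_rank_le_one)
    (hrk : W.mordellWeilRank = 1) (hsha : Finite (AddCommGroup.primaryComponent W.sha p))
    {FB₁ : W.FineSelmerDualData κ γ} (P₁ : Kobayashi2003.EtaColemanPoitouTateData p K₀ η V f ϖ κ γ W I FB₁)
    {z₁ : I.H} (hz₁ : IsAdmissibleZetaClass W p κ hκ I z₁) {a b : ℕ}
    (hT1 : ((p : IwasawaAlgebra p) ^ a) • P₁.z = ((p : IwasawaAlgebra p) ^ b) • z₁)
    {FB : W.FineSelmerDualData κ γ} (P : Kobayashi2003.EtaColemanPoitouTateData p K₀ η V f ϖ κ γ W I FB)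
    {z₀ : I.H} (hz₀ : IsAdmissibleZetaClass W p κ hκ I z₀)
    (𝔮 : PrimeSpectrum (IwasawaAlgebra p)) (h𝔮 : 𝔮.asIdeal = augIdealP p) :
    (lengthAt (IwasawaAlgebra p) (IwasawaAlgebra p ⧸ Ideal.span {P.colPlus z₀}) 𝔮 =
        lengthAt (IwasawaAlgebra p) (IwasawaAlgebra p ⧸ Ideal.span {P.colPlus P.z}) 𝔮) ↔ a = b :=
  stub2c_iff_exponent_eq hp K₀ η hη hη1 V hCM hgood hap hf ϖ hϖ κ γ hκ hγ hγK hvar W I hF hstar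
    (Summit.BirchSwinnertonDyer.Rank1Residual.Additive.LocPKummer.rank_integralH1_le_one W p κ hrk hsha)
    P₁ hz₁ hT1 P hz₀ 𝔮 h𝔮

/-- **(T1) with `a = b` ⟹ stub 2c on the pin** — the `→`-free reading: a `ℚ_pˣ`-proportionality with EQUAL exponents is
«ZC» at `P₁` (torsion-freeness divides `p^a` out), so §1 applies; recorded as the corollary of `stub2c_iff_exponent_eq`.
[cite: Kato2004Asterisque, Thm. 12.4 (2) and Thm. 12.5 (1) (p. 221)] [cite: Kobayashi2003, Thm. 6.3 (p. 11), Thm. 7.3 i) (p. 13)] -/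
theorem stub2c_of_proportional_of_eq (hF : PublishedInputsEtaUpToP)
    (hstar : exists_zetaClassPosition_of_rank_le_one)
    (hrank : Module.rank ℤ_[p] (integralH1 (tateRep W p) p (κ.layerSubgroup 0)) ≤ 1)
    {FB₁ : W.FineSelmerDualData κ γ} (P₁ : Kobayashi2003.EtaColemanPoitouTateData p K₀ η V f ϖ κ γ W I FB₁)
    {z₁ : I.H} (hz₁ : IsAdmissibleZetaClass W p κ hκ I z₁) {a : ℕ}
    (hT : ((p : IwasawaAlgebra p) ^ a) • P₁.z = ((p : IwasawaAlgebra p) ^ a) • z₁)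
    {FB : W.FineSelmerDualData κ γ} (P : Kobayashi2003.EtaColemanPoitouTateData p K₀ η V f ϖ κ γ W I FB)
    {z₀ : I.H} (hz₀ : IsAdmissibleZetaClass W p κ hκ I z₀)
    (𝔮 : PrimeSpectrum (IwasawaAlgebra p)) (h𝔮 : 𝔮.asIdeal = augIdealP p) :
    lengthAt (IwasawaAlgebra p) (IwasawaAlgebra p ⧸ Ideal.span {P.colPlus z₀}) 𝔮 =
      lengthAt (IwasawaAlgebra p) (IwasawaAlgebra p ⧸ Ideal.span {P.colPlus P.z}) 𝔮 :=
  (stub2c_iff_exponent_eq hp K₀ η hη hη1 V hCM hgood hap hf ϖ hϖ κ γ hκ hγ hγK hvar W I hF hstar hrank P₁ hz₁ hT P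
    hz₀ 𝔮 h𝔮).mpr rfl

end Split

end Summit.BirchSwinnertonDyer.BirchSwinnertonDyer.Theorems.CccOneAdmissiblePackage

end
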